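import Summits.BirchSwinnertonDyer.BirchSwinnertonDyer.Theorems.EdixhovenFibreFiveSevenStarredOptimalManinUnitFiveSevenKatoNeronIsogenyTransport
import Literature.NumberTheory.EllipticCurves.KatoAdditiveTwistedValueNeronIntegralityFiveSeven
import HarnessLib

/-!
# F″ programme, piece P6 for the SIBLING readings: the same one-member sockets for Kato's Néron-unit
# integrality at `p > 7` (`kato_neron_isIntegral_twistedSymbolSum_of_additive`) and for the polar reading at
# `p ∈ {5, 7}` (`kato_neron_isIntegral_twistedSymbolSum_of_additive_five_seven_polar`)
# (route `EdixhovenFibreFiveSeven`, crux K★ stmt-BirchSwinnertonDyer-22226, line `kato-lever`; `--supports` 22226, helper)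

Cell `pub/bsd-wall`, seat `bsd-line-edix-p4` g2. TOOL theorems only (no definition, no named fact, no `sorry`);
nothing is closed or booked; BSD is not proved by any of this.

The sibling file `…KatoNeronIsogenyTransport` (p597552) proves that the two CONCLUSION clauses shared verbatim by
the three cite-only Kato–Néron readings of the tree — F′ = `kato_neron_isIntegral_twistedSymbolSum_of_additive`
(`p > 7`, consumer: AKR crux #7's unit-twist lever), F″ = `…_of_additive_five_le` (`p ≥ 5` off the
Kosters–Pannekoek class; consumer: K★ / TDS57 / KP57 / AKR #7) and F‴ = `…_of_additive_five_seven_polar`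
(`p ∈ {5,7}`, polar clause; consumer: cell `bsd-f2-manin`) — pass from ONE globally minimal member of a
`ℚ`-isogeny class to every globally minimal member with `E[p]` irreducible (`body_of_isIsogenous`), and
gives the socket `kato_neron_five_le_of_forall_exists_member` for F″. This file records the same sockets for
F′ and F‴, so that ONE proof of the shared conclusion at Kato's member `E•` (programme pieces P1–P4 of
`Cruxes/StarredOptimalManinUnitFiveSeven/Lines/kato-lever-F2-programme.md`) closes all three readings by `exact`:

* `kato_neron_additive_of_forall_exists_member` / `…_member'` — F′ from its conclusion at one globally
  minimal member per class (resp. granted only under the member's own hypotheses `IsNewformOf`, not good,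
  not multiplicative, `E[p]` irreducible — `hyps_of_isIsogenous`);
* `polar_hyps_of_isIsogenous` — F‴'s POLAR clause `χ(p)^{p−1} ≠ 1 ∨ (V(ℚ_p) has a point of order p ∧ χ(p) ≠ 1)`
  moves along the class under irreducibility (a `ℚ_p`-rational point of order `p` on `V` pushes to one on
  `W` along a prime-to-`p` isogeny: `TorsTwist.exists_prime_smul_eq_zero_of_isIsogenous`);
* `kato_neron_five_seven_polar_of_forall_exists_member` / `…_member'` — F‴ from its conclusion at one
  globally minimal member per class (resp. under the member's own hypotheses, polar clause included).

References: [GreenbergVatsal2000] §3 Remark 3.4; [Kato2004Asterisque] §8.3 (p. 181), (8.1.3) (p. 180);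
[KostersPannekoek2017] §3.3.1; [SilvermanAEC2009] Cor. III.4.11.
-/

set_option autoImplicit false
-- the Theorems namespace of a single-conjunct summit repeats the summit name by design (D-0017)
set_option linter.dupNamespace false

noncomputable section

open scoped MatrixGroups ModularForm Classical
open CongruenceSubgroup WeierstrassCurve Literature.NumberTheory.EllipticCurves
  Literature.NumberTheory.EllipticCurves.ModularForms Literature.NumberTheory.EllipticCurves.Rank1Residual
  Summit.BirchSwinnertonDyer.Rank1Residual

namespace Summit.BirchSwinnertonDyer.BirchSwinnertonDyer.Theorems.KatoNeronIsogenyTransport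

/-! ## §1 F′ (`p > 7`): `kato_neron_isIntegral_twistedSymbolSum_of_additive` from one member per class -/

/-- **F′ from its conclusion at one globally minimal member of each isogeny class** (`p > 7` reading
`kato_neron_isIntegral_twistedSymbolSum_of_additive`: same two conclusion clauses as F″, no Kosters–Pannekoek
clause): if for every globally minimal `V` satisfying F′'s hypotheses at `(f, p, m, χ)` some globally minimal
`W ∼ V` carries the two clauses, then F′ (`body_of_isIsogenous`; `V[p]` irreducible is among the hypotheses).
[cite: Kato2004Asterisque, §8.3 (p. 181) and (8.1.3) (p. 180)] [cite: GreenbergVatsal2000, §3 Remark 3.4] -/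
theorem kato_neron_additive_of_forall_exists_member
    (H : ∀ (V : WeierstrassCurve ℚ) [V.IsElliptic] [V.IsGloballyMinimal] {N : ℕ} [NeZero N]
      (f : CuspForm (Gamma0 N) 2), IsNewformOf V f → ∀ (p : ℕ) [Fact p.Prime], 7 < p →
      ¬ V.HasGoodReductionAtPrime p → ¬ V.HasMultiplicativeReductionAtPrime p →
      V.HasIrreducibleModPGaloisRep p → ∀ (m : ℕ) [NeZero m], m.Coprime (p * N) →
      ∀ (χ : DirichletCharacter ℂ m), χ.IsPrimitive → χ ≠ 1 → ¬ p ∣ orderOf χ →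
      ∃ (W : WeierstrassCurve ℚ) (_ : W.IsElliptic) (_ : W.IsGloballyMinimal), IsIsogenous V W ∧
        ∀ (ϖ : ℚ) (r : ℂ),
          (χ.Even → (ϖ : ℝ) * W.realPeriodRat = plusPeriod f →
            (∏ ℓ ∈ N.primeFactors with ¬ ℓ ^ 2 ∣ N,
                (((ℓ : ℂ) - (W.LFunction ℓ : ℂ) * χ (ℓ : ZMod m)) *
                  ((ℓ : ℂ) - (W.LFunction ℓ : ℂ) * (χ (ℓ : ZMod m))⁻¹))) *
                twistedSymbolSum f χ = r * (plusPeriod f : ℂ) →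
            ∃ s : ℕ, ¬ p ∣ s ∧ IsIntegral ℤ ((s : ℂ) * ϖ * r)) ∧
          (χ.Odd → (ϖ : ℝ) * W.imaginaryPeriodRat = minusPeriod f →
            (∏ ℓ ∈ N.primeFactors with ¬ ℓ ^ 2 ∣ N,
                (((ℓ : ℂ) - (W.LFunction ℓ : ℂ) * χ (ℓ : ZMod m)) *
                  ((ℓ : ℂ) - (W.LFunction ℓ : ℂ) * (χ (ℓ : ZMod m))⁻¹))) *
                twistedSymbolSum f χ = r * (minusPeriod f : ℂ) * Complex.I →
            ∃ s : ℕ, ¬ p ∣ s ∧ IsIntegral ℤ ((s : ℂ) * ϖ * r))) :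
    kato_neron_isIntegral_twistedSymbolSum_of_additive := by
  intro V _ _ N _ f hf p _ hp7 hgood hmult hirr m _ hm χ hχ hχ1 hord ϖ r
  obtain ⟨W, hWE, hWM, hiso, hbody⟩ := H V f hf p hp7 hgood hmult hirr m hm χ hχ hχ1 hord
  exact body_of_isIsogenous hiso hirr hf χ hbody ϖ r

/-- **F′ from its conclusion at one member, granted under the member's own hypotheses** (`IsNewformOf W f`,
`W` neither good nor multiplicative at `p`, `W[p]` irreducible — supplied by `hyps_of_isIsogenous`).
[cite: Kato2004Asterisque, §8.3 (p. 181) and (8.1.3) (p. 180)] [cite: GreenbergVatsal2000, §3 Remark 3.4] -/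
theorem kato_neron_additive_of_forall_exists_member'
    (H : ∀ (V : WeierstrassCurve ℚ) [V.IsElliptic] [V.IsGloballyMinimal] {N : ℕ} [NeZero N]
      (f : CuspForm (Gamma0 N) 2), IsNewformOf V f → ∀ (p : ℕ) [Fact p.Prime], 7 < p →
      ¬ V.HasGoodReductionAtPrime p → ¬ V.HasMultiplicativeReductionAtPrime p →
      V.HasIrreducibleModPGaloisRep p → ∀ (m : ℕ) [NeZero m], m.Coprime (p * N) →
      ∀ (χ : DirichletCharacter ℂ m), χ.IsPrimitive → χ ≠ 1 → ¬ p ∣ orderOf χ →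
      ∃ (W : WeierstrassCurve ℚ) (_ : W.IsElliptic) (_ : W.IsGloballyMinimal), IsIsogenous V W ∧
        (IsNewformOf W f → ¬ W.HasGoodReductionAtPrime p → ¬ W.HasMultiplicativeReductionAtPrime p →
          W.HasIrreducibleModPGaloisRep p →
        ∀ (ϖ : ℚ) (r : ℂ),
          (χ.Even → (ϖ : ℝ) * W.realPeriodRat = plusPeriod f →
            (∏ ℓ ∈ N.primeFactors with ¬ ℓ ^ 2 ∣ N,
                (((ℓ : ℂ) - (W.LFunction ℓ : ℂ) * χ (ℓ : ZMod m)) *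
                  ((ℓ : ℂ) - (W.LFunction ℓ : ℂ) * (χ (ℓ : ZMod m))⁻¹))) *
                twistedSymbolSum f χ = r * (plusPeriod f : ℂ) →
            ∃ s : ℕ, ¬ p ∣ s ∧ IsIntegral ℤ ((s : ℂ) * ϖ * r)) ∧
          (χ.Odd → (ϖ : ℝ) * W.imaginaryPeriodRat = minusPeriod f →
            (∏ ℓ ∈ N.primeFactors with ¬ ℓ ^ 2 ∣ N,
                (((ℓ : ℂ) - (W.LFunction ℓ : ℂ) * χ (ℓ : ZMod m)) *
                  ((ℓ : ℂ) - (W.LFunction ℓ : ℂ) * (χ (ℓ : ZMod m))⁻¹))) *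
                twistedSymbolSum f χ = r * (minusPeriod f : ℂ) * Complex.I →
            ∃ s : ℕ, ¬ p ∣ s ∧ IsIntegral ℤ ((s : ℂ) * ϖ * r)))) :
    kato_neron_isIntegral_twistedSymbolSum_of_additive := by
  refine kato_neron_additive_of_forall_exists_member
    fun V _ _ N _ f hf p _ hp7 hgood hmult hirr m _ hm χ hχ hχ1 hord ↦ ?_
  obtain ⟨W, hWE, hWM, hiso, hbody⟩ := H V f hf p hp7 hgood hmult hirr m hm χ hχ hχ1 hord
  obtain ⟨hfW, hgoodW, hmultW, hirrW, -⟩ :=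
    hyps_of_isIsogenous (p := p) (m := m) hiso hf hgood hmult hirr (Or.inl hp7)
  exact ⟨W, hWE, hWM, hiso, hbody hfW hgoodW hmultW hirrW⟩

/-! ## §2 F‴ (`p ∈ {5, 7}`, polar clause): `kato_neron_isIntegral_twistedSymbolSum_of_additive_five_seven_polar` -/

section Polar

variable {p : ℕ} [Fact p.Prime] {V W : WeierstrassCurve ℚ} [V.IsElliptic] [W.IsElliptic]

/-- **F‴'s polar clause moves along a `ℚ`-isogeny class under irreducibility**: the character-side disjunct
`χ(p)^{p−1} ≠ 1` does not mention the curve, and a `ℚ_p`-rational point of order `p` on `V` pushes to one on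
any `W ∼ V` along a `ℚ`-isogeny of degree prime to `p` (`TorsTwist.exists_prime_smul_eq_zero_of_isIsogenous`,
with `W[p]` irreducible from `V[p]` irreducible). [cite: SilvermanAEC2009, Cor. III.4.11] -/
theorem polar_hyps_of_isIsogenous (hiso : IsIsogenous V W) (hirr : V.HasIrreducibleModPGaloisRep p)
    {m : ℕ} {χ : DirichletCharacter ℂ m}
    (hpol : χ (p : ZMod m) ^ (p - 1) ≠ 1 ∨
      ((∃ P : (V.baseChange ℚ_[p]).toAffine.Point, P ≠ 0 ∧ p • P = 0) ∧ χ (p : ZMod m) ≠ 1)) :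
    χ (p : ZMod m) ^ (p - 1) ≠ 1 ∨
      ((∃ P : (W.baseChange ℚ_[p]).toAffine.Point, P ≠ 0 ∧ p • P = 0) ∧ χ (p : ZMod m) ≠ 1) := by
  rcases hpol with h | ⟨⟨P, hP0, hP⟩, hχ⟩
  · exact Or.inl h
  · have hirrW : Irr W p := (X12.irr_iff_of_isIsogenous hiso p).mp hirr
    have hPz : (p : ℤ) • P = 0 := by rw [natCast_zsmul]; exact hP
    obtain ⟨P₀, hP₀, hP₀p⟩ :=
      TorsTwist.exists_prime_smul_eq_zero_of_isIsogenous hirrW hiso.symm_of_charZero hP0 hPz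
    exact Or.inr ⟨⟨P₀, hP₀, by rw [← natCast_zsmul]; exact hP₀p⟩, hχ⟩

end Polar

/-- **F‴ from its conclusion at one globally minimal member of each isogeny class** (the `p ∈ {5,7}` polar
reading `kato_neron_isIntegral_twistedSymbolSum_of_additive_five_seven_polar`): if for every globally minimal
`V` satisfying F‴'s hypotheses at `(f, p, m, χ)` some globally minimal `W ∼ V` carries the two conclusion
clauses, then F‴ (`body_of_isIsogenous`).
[cite: Kato2004Asterisque, §8.3 (p. 181) and (8.1.3) (p. 180)] [cite: KostersPannekoek2017, §3.3.1]
[cite: GreenbergVatsal2000, §3 Remark 3.4] -/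
theorem kato_neron_five_seven_polar_of_forall_exists_member
    (H : ∀ (V : WeierstrassCurve ℚ) [V.IsElliptic] [V.IsGloballyMinimal] {N : ℕ} [NeZero N]
      (f : CuspForm (Gamma0 N) 2), IsNewformOf V f → ∀ (p : ℕ) [Fact p.Prime], (p = 5 ∨ p = 7) →
      ¬ V.HasGoodReductionAtPrime p → ¬ V.HasMultiplicativeReductionAtPrime p →
      V.HasIrreducibleModPGaloisRep p → ∀ (m : ℕ) [NeZero m], m.Coprime (p * N) →
      ∀ (χ : DirichletCharacter ℂ m), χ.IsPrimitive → χ ≠ 1 → ¬ p ∣ orderOf χ →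
      (χ (p : ZMod m) ^ (p - 1) ≠ 1 ∨
        ((∃ P : (V.baseChange ℚ_[p]).toAffine.Point, P ≠ 0 ∧ p • P = 0) ∧ χ (p : ZMod m) ≠ 1)) →
      ∃ (W : WeierstrassCurve ℚ) (_ : W.IsElliptic) (_ : W.IsGloballyMinimal), IsIsogenous V W ∧
        ∀ (ϖ : ℚ) (r : ℂ),
          (χ.Even → (ϖ : ℝ) * W.realPeriodRat = plusPeriod f →
            (∏ ℓ ∈ N.primeFactors with ¬ ℓ ^ 2 ∣ N,
                (((ℓ : ℂ) - (W.LFunction ℓ : ℂ) * χ (ℓ : ZMod m)) *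
                  ((ℓ : ℂ) - (W.LFunction ℓ : ℂ) * (χ (ℓ : ZMod m))⁻¹))) *
                twistedSymbolSum f χ = r * (plusPeriod f : ℂ) →
            ∃ s : ℕ, ¬ p ∣ s ∧ IsIntegral ℤ ((s : ℂ) * ϖ * r)) ∧
          (χ.Odd → (ϖ : ℝ) * W.imaginaryPeriodRat = minusPeriod f →
            (∏ ℓ ∈ N.primeFactors with ¬ ℓ ^ 2 ∣ N,
                (((ℓ : ℂ) - (W.LFunction ℓ : ℂ) * χ (ℓ : ZMod m)) *
                  ((ℓ : ℂ) - (W.LFunction ℓ : ℂ) * (χ (ℓ : ZMod m))⁻¹))) *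
                twistedSymbolSum f χ = r * (minusPeriod f : ℂ) * Complex.I →
            ∃ s : ℕ, ¬ p ∣ s ∧ IsIntegral ℤ ((s : ℂ) * ϖ * r))) :
    kato_neron_isIntegral_twistedSymbolSum_of_additive_five_seven_polar := by
  intro V _ _ N _ f hf p _ hp57 hgood hmult hirr m _ hm χ hχ hχ1 hord hpol ϖ r
  obtain ⟨W, hWE, hWM, hiso, hbody⟩ := H V f hf p hp57 hgood hmult hirr m hm χ hχ hχ1 hord hpol
  exact body_of_isIsogenous hiso hirr hf χ hbody ϖ r

/-- **F‴ from its conclusion at one member, granted under the member's own hypotheses, polar clause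
included** (`hyps_of_isIsogenous` for the newform / reduction / irreducibility, `polar_hyps_of_isIsogenous` for
the polar clause). [cite: Kato2004Asterisque, §8.3 (p. 181) and (8.1.3) (p. 180)] [cite: KostersPannekoek2017, §3.3.1]
[cite: GreenbergVatsal2000, §3 Remark 3.4] -/
theorem kato_neron_five_seven_polar_of_forall_exists_member'
    (H : ∀ (V : WeierstrassCurve ℚ) [V.IsElliptic] [V.IsGloballyMinimal] {N : ℕ} [NeZero N]
      (f : CuspForm (Gamma0 N) 2), IsNewformOf V f → ∀ (p : ℕ) [Fact p.Prime], (p = 5 ∨ p = 7) →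
      ¬ V.HasGoodReductionAtPrime p → ¬ V.HasMultiplicativeReductionAtPrime p →
      V.HasIrreducibleModPGaloisRep p → ∀ (m : ℕ) [NeZero m], m.Coprime (p * N) →
      ∀ (χ : DirichletCharacter ℂ m), χ.IsPrimitive → χ ≠ 1 → ¬ p ∣ orderOf χ →
      (χ (p : ZMod m) ^ (p - 1) ≠ 1 ∨
        ((∃ P : (V.baseChange ℚ_[p]).toAffine.Point, P ≠ 0 ∧ p • P = 0) ∧ χ (p : ZMod m) ≠ 1)) →
      ∃ (W : WeierstrassCurve ℚ) (_ : W.IsElliptic) (_ : W.IsGloballyMinimal), IsIsogenous V W ∧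
        (IsNewformOf W f → ¬ W.HasGoodReductionAtPrime p → ¬ W.HasMultiplicativeReductionAtPrime p →
          W.HasIrreducibleModPGaloisRep p →
          (χ (p : ZMod m) ^ (p - 1) ≠ 1 ∨
            ((∃ P : (W.baseChange ℚ_[p]).toAffine.Point, P ≠ 0 ∧ p • P = 0) ∧ χ (p : ZMod m) ≠ 1)) →
        ∀ (ϖ : ℚ) (r : ℂ),
          (χ.Even → (ϖ : ℝ) * W.realPeriodRat = plusPeriod f →
            (∏ ℓ ∈ N.primeFactors with ¬ ℓ ^ 2 ∣ N,
                (((ℓ : ℂ) - (W.LFunction ℓ : ℂ) * χ (ℓ : ZMod m)) *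
                  ((ℓ : ℂ) - (W.LFunction ℓ : ℂ) * (χ (ℓ : ZMod m))⁻¹))) *
                twistedSymbolSum f χ = r * (plusPeriod f : ℂ) →
            ∃ s : ℕ, ¬ p ∣ s ∧ IsIntegral ℤ ((s : ℂ) * ϖ * r)) ∧
          (χ.Odd → (ϖ : ℝ) * W.imaginaryPeriodRat = minusPeriod f →
            (∏ ℓ ∈ N.primeFactors with ¬ ℓ ^ 2 ∣ N,
                (((ℓ : ℂ) - (W.LFunction ℓ : ℂ) * χ (ℓ : ZMod m)) *
                  ((ℓ : ℂ) - (W.LFunction ℓ : ℂ) * (χ (ℓ : ZMod m))⁻¹))) *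
                twistedSymbolSum f χ = r * (minusPeriod f : ℂ) * Complex.I →
            ∃ s : ℕ, ¬ p ∣ s ∧ IsIntegral ℤ ((s : ℂ) * ϖ * r)))) :
    kato_neron_isIntegral_twistedSymbolSum_of_additive_five_seven_polar := by
  refine kato_neron_five_seven_polar_of_forall_exists_member
    fun V _ _ N _ f hf p _ hp57 hgood hmult hirr m _ hm χ hχ hχ1 hord hpol ↦ ?_
  obtain ⟨W, hWE, hWM, hiso, hbody⟩ := H V f hf p hp57 hgood hmult hirr m hm χ hχ hχ1 hord hpol
  have hadd : Addv W p := (X2.addv_iff_of_isIsogenous (p := p) hiso).mp ⟨hgood, hmult⟩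
  exact ⟨W, hWE, hWM, hiso, hbody (hf.of_isIsogenous hiso.symm_of_charZero) hadd.1 hadd.2
    ((X12.irr_iff_of_isIsogenous hiso p).mp hirr) (polar_hyps_of_isIsogenous hiso hirr hpol)⟩

end Summit.BirchSwinnertonDyer.BirchSwinnertonDyer.Theorems.KatoNeronIsogenyTransport

end
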